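import Summits.ValiantsHypothesis.ValiantsHypothesis.Theorems.KPlusLogSqLawTropicalBSingleGaugeUniversalLemmas

/-!
# Route «KPlusLogSqLaw», crux `TropicalB` (stmt-ValiantsHypothesis-19771) — THE UNIVERSAL SINGLE-GAUGE BOUND `n ≤ (K−2)·m² + m`

HONEST FRAMING.  Helper `--supports` the crux `…Theses.KPlusLogSqLaw.TropicalB` (item stmt-ValiantsHypothesis-19771, route KPlusLogSqLaw, DRAFT;
cell `pub-symmetroid`, seat val-sym-trop-p5 g11, 2026-08-27).  A STRUCTURE theorem on dominant chains of ARBITRARY designs (every `m`, `K`)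
certified column-wise by ONE affine row gauge with pairwise distinct gauged slopes `d_l − α_i` (hypothesis of `chain_le_of_genericGauge`), a
least and a greatest exponent class.  Nothing here bears on `TropicalB` in its window, `WeakLifting`, the doors, `MatrixDescartes`
(stmt-ValiantsHypothesis-18050) or VP ≠ VNP.
* `chain_le_of_universalGauge` / `…'`: **`n ≤ m·(#{middle incidence types} + 1) = (K−2)·m² + m`** (`K = 4`: `2m² + m`; tree's single-gauge law
  p554764: `m(mK−1) = 4m² − m`; located optimum over all gauges = DIAMOND's `(K−3)m² + 2m`, memo SINGLE-GAUGE-CEILING-g11 — not claimed here).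
PROOF: universal per-token potential `ψ = #{MIDDLE types of larger gauged slope} + [class ≠ top]` (lemmas in `…UniversalLemmas`); per step,
relabelled columns drop `≥ 1`; over the row-changed columns (row permutation `π = σ_a⁻¹σ_b`) the drop is `≥ #descents − #X` (`X` = bottom
landings whose successor departs from the top), descents = rising rows, and `#rising ≥ #X + 1` by the cut inequality, the rank argument «no
rising row spans an X-block» and the greedy lemma `card_le_card_coverers`.  [this seat]
-/


set_option linter.dupNamespace false
set_option autoImplicit false

namespace Summit.ValiantsHypothesis.ValiantsHypothesis.Theorems.KPlusLogSqLaw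

open Summit.ValiantsHypothesis.ValiantsHypothesis.Theorems.MatrixDescartes.Negative
open scoped BigOperators
open Finset

namespace SingleGauge

variable {m K : ℕ}

/-- **THE UNIVERSAL SINGLE-GAUGE BOUND.**  A dominant chain with distinct consecutive terms, certified column-wise at every time by ONE affine row
gauge (`hcert`, verbatim as in `chain_le_of_singleGauge`) with pairwise distinct gauged slopes (`hgen`), a least exponent class `l₀` and a greatest
one `l₁` with `d l₀ < d l₁`, has `n ≤ m · (#{(i,l) : l ≠ l₀ ∧ l ≠ l₁} + 1) = (K−2)m² + m`. [this seat; potential `#middle-after + [not top]`] -/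
theorem chain_le_of_universalGauge (d : Fin K → ℕ) (v ε : Fin m → Fin m → Fin K → ℤ) (α β : Fin m → ℚ)
    (hgen : ∀ (i i' : Fin m) (l l' : Fin K), (d l : ℚ) - α i = (d l' : ℚ) - α i' → i = i' ∧ l = l')
    (l₀ l₁ : Fin K) (hd0 : ∀ l, d l₀ ≤ d l) (hd1 : ∀ l, d l ≤ d l₁) (h01 : d l₀ < d l₁)
    {n : ℕ} (θ : Fin (n + 1) → ℤ) (hθ : StrictMono θ) (p : Fin (n + 1) → Equiv.Perm (Fin m) × (Fin m → Fin K))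
    (hdom : ∀ k, IsDominant d v ε (θ k) (p k)) (hne : ∀ k : Fin n, p k.castSucc ≠ p k.succ)
    (hcert : ∀ (k : Fin (n + 1)) (j i : Fin m) (l : Fin K), ε i j l ≠ 0 →
      ((θ k : ℚ) * (d l : ℚ) - (v i j l : ℚ)) - (α i * (θ k : ℚ) + β i) ≤
        ((θ k : ℚ) * (d ((p k).2 j) : ℚ) - (v ((p k).1 j) j ((p k).2 j) : ℚ)) - (α ((p k).1 j) * (θ k : ℚ) + β ((p k).1 j))) :
    n ≤ m * ((univ.filter fun il : Fin m × Fin K => il.2 ≠ l₀ ∧ il.2 ≠ l₁).card + 1) := by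
  -- gauged slopes and the universal weight
  let g : Fin m → Fin K → ℚ := fun i l => (d l : ℚ) - α i
  let Mid : Finset (Fin m × Fin K) := univ.filter fun il : Fin m × Fin K => il.2 ≠ l₀ ∧ il.2 ≠ l₁
  let Ψ : Fin m → ℚ → ℤ := fun i γ =>
    ((univ.filter fun il : Fin m × Fin K => il.2 ≠ l₀ ∧ il.2 ≠ l₁ ∧ γ < (d il.2 : ℚ) - α il.1).card : ℤ) +
      (if γ < (d l₁ : ℚ) - α i then 1 else 0)
  have hΨnn : ∀ i γ, 0 ≤ Ψ i γ := fun i γ => by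
    have h1 : (0:ℤ) ≤ (if γ < (d l₁ : ℚ) - α i then (1:ℤ) else 0) := by split_ifs <;> norm_num
    have h2 : (0:ℤ) ≤ ((univ.filter fun il : Fin m × Fin K => il.2 ≠ l₀ ∧ il.2 ≠ l₁ ∧ γ < (d il.2 : ℚ) - α il.1).card : ℤ) :=
      Int.natCast_nonneg _
    show (0:ℤ) ≤ ((univ.filter fun il : Fin m × Fin K => il.2 ≠ l₀ ∧ il.2 ≠ l₁ ∧ γ < (d il.2 : ℚ) - α il.1).card : ℤ) +
      (if γ < (d l₁ : ℚ) - α i then 1 else 0)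
    linarith
  have hΨle : ∀ i γ, Ψ i γ ≤ (Mid.card : ℤ) + 1 := fun i γ => by
    have h1 : ((univ.filter fun il : Fin m × Fin K => il.2 ≠ l₀ ∧ il.2 ≠ l₁ ∧ γ < (d il.2 : ℚ) - α il.1).card : ℤ) ≤ Mid.card := by
      exact_mod_cast card_le_card (fun il hil => by rw [mem_filter] at hil ⊢; exact ⟨hil.1, hil.2.1, hil.2.2.1⟩)
    have h2 : (if γ < (d l₁ : ℚ) - α i then (1:ℤ) else 0) ≤ 1 := by split_ifs <;> norm_num
    simp only [Ψ]; linarith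
  -- basic slope facts
  have gbot : ∀ i l, g i l₀ ≤ g i l := fun i l => by
    have h : (d l₀ : ℚ) ≤ (d l : ℚ) := by exact_mod_cast hd0 l
    exact sub_le_sub_right h _
  have gtop : ∀ i l, g i l ≤ g i l₁ := fun i l => by
    have h : (d l : ℚ) ≤ (d l₁ : ℚ) := by exact_mod_cast hd1 l
    exact sub_le_sub_right h _
  have g01 : ∀ i, g i l₀ < g i l₁ := fun i => sub_lt_sub_right (by exact_mod_cast h01) _
  -- the same row order for every class: larger α = smaller slopes
  have grow : ∀ i i' l l', g i l ≤ g i' l → g i l' ≤ g i' l' := fun i i' l l' h => by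
    simp only [g] at h ⊢; linarith
  let Φ : Fin (n + 1) → ℤ := fun t => ∑ j, Ψ ((p t).1 j) (g ((p t).1 j) ((p t).2 j))
  -- ONE STEP
  have hstep : ∀ k : Fin n, Φ k.succ + 1 ≤ Φ k.castSucc := by
    intro k
    set a := k.castSucc with ha
    set b := k.succ with hb
    have hab : (θ a : ℚ) < (θ b : ℚ) := by exact_mod_cast hθ (Fin.castSucc_lt_succ (i := k))
    let gx : Fin m → ℚ := fun j => g ((p a).1 j) ((p a).2 j)
    let gz : Fin m → ℚ := fun j => g ((p b).1 j) ((p b).2 j)          -- actual new slope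
    let πe : Equiv.Perm (Fin m) := (p b).1.trans (p a).1.symm          -- πe j = σa⁻¹ (σb j)
    have hπ : ∀ j, (p a).1 (πe j) = (p b).1 j := fun j => by simp [πe]
    let go : Fin m → ℚ := fun j => gx (πe j)                            -- old slope of the new row of j
    have hgo : ∀ j, go j = g ((p b).1 j) ((p a).2 (πe j)) := fun j => by simp only [go, gx, hπ]
    have hmono : ∀ j, gx j ≤ gz j := by
      intro j
      have e1 := eps_ne_zero_of_isDominant (hdom a) j
      have e2 := eps_ne_zero_of_isDominant (hdom b) j
      have c1 := hcert a j ((p b).1 j) ((p b).2 j) e2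
      have c2 := hcert b j ((p a).1 j) ((p a).2 j) e1
      show (d ((p a).2 j) : ℚ) - α ((p a).1 j) ≤ (d ((p b).2 j) : ℚ) - α ((p b).1 j)
      nlinarith
    have hstrict : ∀ j, ((p a).1 j ≠ (p b).1 j ∨ (p a).2 j ≠ (p b).2 j) → gx j < gz j := by
      intro j hch
      refine lt_of_le_of_ne (hmono j) fun heq => ?_
      obtain ⟨h1, h2⟩ := hgen _ _ _ _ heq
      rcases hch with h | h
      · exact h h1
      · exact h h2
    let C : Finset (Fin m) := univ.filter fun j => (p a).1 j ≠ (p b).1 j ∨ (p a).2 j ≠ (p b).2 j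
    let Crow : Finset (Fin m) := univ.filter fun j => (p a).1 j ≠ (p b).1 j
    have hCrowC : Crow ⊆ C := fun j hj => by rw [mem_filter] at hj ⊢; exact ⟨hj.1, Or.inl hj.2⟩
    let Sset : Fin m → Finset (Fin K) := fun j => univ.filter fun l => gx j < g ((p b).1 j) l
    have hSne : ∀ j ∈ C, (Sset j).Nonempty := fun j hj => by
      rw [mem_filter] at hj
      exact ⟨(p b).2 j, by rw [mem_filter]; exact ⟨mem_univ _, hstrict j hj.2⟩⟩
    let gy : Fin m → ℚ := fun j =>
      if h : (Sset j).Nonempty then ((Sset j).image fun l => g ((p b).1 j) l).min' (h.image _) else gx j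
    have gy_spec : ∀ j ∈ C, (∃ f, gx j < g ((p b).1 j) f ∧ gy j = g ((p b).1 j) f) ∧
        (∀ l, gx j < g ((p b).1 j) l → gy j ≤ g ((p b).1 j) l) := by
      intro j hj
      have hS := hSne j hj
      have hdef : gy j = ((Sset j).image fun l => g ((p b).1 j) l).min' (hS.image _) := by simp only [gy, dif_pos hS]
      constructor
      · have hmem := min'_mem ((Sset j).image fun l => g ((p b).1 j) l) (hS.image _)
        rw [← hdef, mem_image] at hmem
        obtain ⟨f, hf, hfe⟩ := hmem
        rw [mem_filter] at hf
        exact ⟨f, hf.2, hfe.symm⟩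
      · intro l hl
        rw [hdef]
        exact min'_le _ _ (mem_image.mpr ⟨l, by rw [mem_filter]; exact ⟨mem_univ _, hl⟩, rfl⟩)
    have gxy : ∀ j ∈ C, gx j < gy j := fun j hj => by
      obtain ⟨⟨f, hf, hfe⟩, -⟩ := gy_spec j hj; rw [hfe]; exact hf
    have gyz : ∀ j ∈ C, gy j ≤ gz j := fun j hj => (gy_spec j hj).2 _ (hstrict j (by rw [mem_filter] at hj; exact hj.2))
    have bot_iff : ∀ j ∈ C, ∀ f, gx j < g ((p b).1 j) f → gy j = g ((p b).1 j) f → (f = l₀ ↔ gx j < g ((p b).1 j) l₀) := by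
      intro j hj f hf hfe
      constructor
      · intro h; rw [h] at hf; exact hf
      · intro h
        have h1 : gy j ≤ g ((p b).1 j) l₀ := (gy_spec j hj).2 l₀ h
        have h2 : g ((p b).1 j) l₀ ≤ g ((p b).1 j) f := gbot _ _
        have : g ((p b).1 j) f = g ((p b).1 j) l₀ := le_antisymm (hfe ▸ h1) h2
        exact (hgen _ _ _ _ this).2
    let val : Fin m → ℤ := fun j =>
      (if gx j < g ((p a).1 j) l₁ then 1 else 0) - (if gx j < g ((p b).1 j) l₀ then 1 else 0)
    have hcolC : ∀ j ∈ C, Ψ ((p b).1 j) (gz j) + val j ≤ Ψ ((p a).1 j) (gx j) := by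
      intro j hj
      obtain ⟨⟨f, hf, hfe⟩, hmin⟩ := gy_spec j hj
      have h1 : Ψ ((p b).1 j) (gz j) ≤ Ψ ((p b).1 j) (gy j) := psiU_antitone d α l₀ l₁ ((p b).1 j) (gyz j hj)
      have h2 := psiU_drop d α l₀ l₁ ((p a).1 j) ((p b).1 j) ((p a).2 j) f hf
      have hb := bot_iff j hj f hf hfe
      have e : (if f = l₀ then (1:ℤ) else 0) = (if gx j < g ((p b).1 j) l₀ then 1 else 0) := by
        by_cases hf0 : f = l₀
        · rw [if_pos hf0, if_pos (hb.mp hf0)]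
        · rw [if_neg hf0, if_neg (fun h => hf0 (hb.mpr h))]
      simp only [Ψ, val, gx, g] at h1 h2 e ⊢
      rw [hfe] at h1
      rw [← e]
      linarith
    have hcol0 : ∀ j, j ∉ C → Ψ ((p b).1 j) (gz j) = Ψ ((p a).1 j) (gx j) := by
      intro j hj
      have : ¬ ((p a).1 j ≠ (p b).1 j ∨ (p a).2 j ≠ (p b).2 j) := fun h => hj (by rw [mem_filter]; exact ⟨mem_univ _, h⟩)
      push Not at this
      simp only [gz, gx, this.1, this.2]
    have hval_relabel : ∀ j ∈ C, j ∉ Crow → val j = 1 := by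
      intro j hj hjr
      have hrow : (p a).1 j = (p b).1 j := by
        by_contra h; exact hjr (by rw [mem_filter]; exact ⟨mem_univ _, h⟩)
      obtain ⟨⟨f, hf, hfe⟩, -⟩ := gy_spec j hj
      have ht : gx j < g ((p a).1 j) l₁ := by rw [hrow]; exact lt_of_lt_of_le hf (gtop _ _)
      have hnb : ¬ (gx j < g ((p b).1 j) l₀) := by
        rw [← hrow]; exact not_lt.mpr (gbot _ _)
      simp only [val, if_pos ht, if_neg hnb]; norm_num
    have hπmem : ∀ j, πe j ∈ Crow ↔ j ∈ Crow := fun j => perm_mem_rowChanged_iff (p a).1 (p b).1 j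
    have hne_go : ∀ j ∈ Crow, gx j ≠ go j := by
      intro j hj heq
      rw [mem_filter] at hj
      have h := hgen _ _ _ _ (show (d ((p a).2 j) : ℚ) - α ((p a).1 j) = (d ((p a).2 (πe j)) : ℚ) - α ((p a).1 (πe j)) from heq)
      rw [hπ j] at h
      exact hj.2 h.1
    have hdesc_iff : ∀ j ∈ Crow, (go j < gx j ↔ go j < gy j) := by
      intro j hj
      have hjC := hCrowC hj
      constructor
      · intro h; exact h.trans (gxy j hjC)
      · intro h
        by_contra hn
        have hlt : gx j < go j := lt_of_le_of_ne (not_lt.mp hn) (hne_go j hj)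
        have := (gy_spec j hjC).2 ((p a).2 (πe j)) (by rw [← hgo j]; exact hlt)
        rw [← hgo j] at this
        exact absurd h (not_lt.mpr this)
    have hasc_a : ∀ j ∈ Crow, gx j < g ((p b).1 j) l₀ → gx j < go j := by
      intro j hj h; rw [hgo j]; exact lt_of_lt_of_le h (gbot _ _)
    have hasc_b : ∀ j ∈ Crow, (p a).2 (πe j) = l₁ → gx j < go j := by
      intro j hj h
      have hjC := hCrowC hj
      obtain ⟨⟨f, hf, hfe⟩, -⟩ := gy_spec j hjC
      rw [hgo j, h]
      exact lt_of_lt_of_le hf (gtop _ _)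
    let A1 : Finset (Fin m) := Crow.filter fun j => (p a).2 j = l₁
    let A2 : Finset (Fin m) := Crow.filter fun j => (p a).2 (πe j) = l₁
    let Bset : Finset (Fin m) := Crow.filter fun j => gx j < g ((p b).1 j) l₀
    let Asc : Finset (Fin m) := Crow.filter fun j => gx j < go j
    let Ris : Finset (Fin m) := Crow.filter fun j => go j < gy j
    let Xset : Finset (Fin m) := Crow.filter fun j => gx j < g ((p b).1 j) l₀ ∧ (p a).2 (πe j) = l₁
    have hA12 : A1.card = A2.card :=
      (card_filter_perm Crow πe hπmem (fun j => (p a).2 j = l₁)).symm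
    have hunion : A2 ∪ Bset ⊆ Asc := by
      intro j hj; rw [mem_union] at hj; rw [mem_filter]
      rcases hj with hj | hj
      · rw [mem_filter] at hj; exact ⟨hj.1, hasc_b j hj.1 hj.2⟩
      · rw [mem_filter] at hj; exact ⟨hj.1, hasc_a j hj.1 hj.2⟩
    have hinter : A2 ∩ Bset = Xset := by
      ext j; simp only [A2, Bset, Xset, mem_inter, mem_filter]; tauto
    have hAB : A2.card + Bset.card ≤ Asc.card + Xset.card := by
      have h1 := card_union_add_card_inter A2 Bset
      rw [hinter] at h1
      have h2 := card_le_card hunion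
      omega
    have hAscDesc : Asc.card + Ris.card = Crow.card := by
      have hRis : Ris = Crow.filter fun j => ¬ (gx j < go j) := by
        ext j; simp only [Ris, mem_filter]
        constructor
        · rintro ⟨hj, h⟩; exact ⟨hj, not_lt.mpr ((hdesc_iff j hj).mpr h).le⟩
        · rintro ⟨hj, h⟩; exact ⟨hj, (hdesc_iff j hj).mp (lt_of_le_of_ne (not_lt.mp h) (fun e => hne_go j hj e.symm))⟩
      rw [hRis]; exact card_filter_add_card_filter_not _
    have hX_gy : ∀ s ∈ Xset, gy s = g ((p b).1 s) l₀ := by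
      intro s hs; rw [mem_filter] at hs
      have hsC := hCrowC hs.1
      obtain ⟨⟨f, hf, hfe⟩, -⟩ := gy_spec s hsC
      have := (bot_iff s hsC f hf hfe).mpr hs.2.1
      rw [hfe, this]
    have hX_go : ∀ s ∈ Xset, go s = g ((p b).1 s) l₁ := by
      intro s hs; rw [mem_filter] at hs; rw [hgo s, hs.2.2]
    have hcut_card : ∀ q : ℚ, (Crow.filter fun j => go j < q).card = (Crow.filter fun j => gx j < q).card :=
      fun q => card_filter_perm Crow πe hπmem (fun j => gx j < q)
    have hcut_card' : ∀ q : ℚ, (Crow.filter fun j => go j ≤ q).card = (Crow.filter fun j => gx j ≤ q).card :=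
      fun q => card_filter_perm Crow πe hπmem (fun j => gx j ≤ q)
    have gxy' : ∀ j ∈ Crow, gx j < gy j := fun j hj => gxy j (hCrowC hj)
    have hLemmaD : Crow.Nonempty → Xset.card + 1 ≤ Ris.card := by
      intro hCne
      have hgreedy := card_le_card_coverers (fun s => g ((p b).1 s) l₀) (fun s => g ((p b).1 s) l₁) go gy
        Xset.card Xset Ris rfl
        (fun s _ => g01 _)
        (fun s _ s' _ h => grow _ _ l₁ l₀ h)
        (fun s hs s' hs' h => by
          have := (hgen _ _ _ _ h).1
          exact (p b).1.injective this)
        (fun s hs => by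
          have hsub1 : (Xset.filter fun s' => g ((p b).1 s') l₀ < g ((p b).1 s) l₁ ∧ g ((p b).1 s) l₁ ≤ g ((p b).1 s') l₁) ⊆
              (Crow.filter fun j => gy j < g ((p b).1 s) l₁ ∧ g ((p b).1 s) l₁ ≤ go j) := by
            intro s' hs'; rw [mem_filter] at hs'
            have hs'X := hs'.1
            rw [mem_filter]
            refine ⟨(mem_filter.mp hs'X).1, ?_, ?_⟩
            · rw [hX_gy s' hs'X]; exact hs'.2.1
            · rw [hX_go s' hs'X]; exact hs'.2.2
          have hsub2 : (Crow.filter fun j => go j < g ((p b).1 s) l₁ ∧ g ((p b).1 s) l₁ ≤ gy j) ⊆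
              (Ris.filter fun w => go w < g ((p b).1 s) l₁ ∧ g ((p b).1 s) l₁ ≤ gy w) := by
            intro j hj; rw [mem_filter] at hj; rw [mem_filter]
            exact ⟨by rw [mem_filter]; exact ⟨hj.1, lt_of_lt_of_le hj.2.1 hj.2.2⟩, hj.2⟩
          have hmid := cut_le Crow gx gy go (g ((p b).1 s) l₁) gxy' (hcut_card _)
          exact (card_le_card hsub1).trans (hmid.trans (card_le_card hsub2)))
        (fun s hs w hw hlt hle => by
          have hsC := hCrowC (mem_filter.mp hs).1
          have hwCrow := (mem_filter.mp hw).1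
          have hwC := hCrowC hwCrow
          obtain ⟨⟨f, hf, hfe⟩, -⟩ := gy_spec w hwC
          have h1 : g ((p b).1 s) l₁ ≤ g ((p b).1 w) l₁ := hle.trans (hfe ▸ gtop _ _)
          have h2 : g ((p b).1 s) l₀ ≤ g ((p b).1 w) ((p a).2 (πe w)) :=
            (grow _ _ l₁ l₀ h1).trans (gbot _ _)
          rw [hgo w]
          refine lt_of_le_of_ne h2 fun heq => ?_
          have hrow := (hgen _ _ _ _ heq).1
          have hsw : s = w := (p b).1.injective hrow
          subst hsw
          have hris := (mem_filter.mp hw).2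
          rw [hX_gy s hs, hX_go s hs] at hris
          exact absurd hris (not_lt.mpr (g01 _).le))
      by_cases hXne : Xset.Nonempty
      · obtain ⟨s₀, hs₀, hmax⟩ := exists_max_image Xset (fun s => α ((p b).1 s)) hXne
        have hLmin : ∀ s ∈ Xset, g ((p b).1 s₀) l₀ ≤ g ((p b).1 s) l₀ := by
          intro s hs; have := hmax s hs; show (d l₀ : ℚ) - α ((p b).1 s₀) ≤ (d l₀ : ℚ) - α ((p b).1 s); linarith
        have hcut := cut_le' Crow gx gy go (g ((p b).1 s₀) l₀) gxy' (hcut_card' _)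
        have hpos : 0 < (Crow.filter fun j => gy j ≤ g ((p b).1 s₀) l₀ ∧ g ((p b).1 s₀) l₀ < go j).card := by
          rw [card_pos]; refine ⟨s₀, ?_⟩; rw [mem_filter]
          refine ⟨(mem_filter.mp hs₀).1, ?_, ?_⟩
          · rw [hX_gy s₀ hs₀]
          · rw [hX_go s₀ hs₀]; exact g01 _
        obtain ⟨w, hw⟩ := card_pos.mp (lt_of_lt_of_le hpos hcut)
        rw [mem_filter] at hw
        obtain ⟨hwCrow, hwle, hwlt⟩ := hw
        have hwRis : w ∈ Ris := by rw [mem_filter]; exact ⟨hwCrow, lt_of_le_of_lt hwle hwlt⟩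
        have hwnot : w ∉ Ris.filter (fun w => ∃ s ∈ Xset, g ((p b).1 s) l₀ < go w) := by
          rw [mem_filter]; rintro ⟨-, s, hs, hlt⟩
          exact absurd (lt_of_lt_of_le hlt hwle) (not_lt.mpr (hLmin s hs))
        have hsub : insert w (Ris.filter (fun w => ∃ s ∈ Xset, g ((p b).1 s) l₀ < go w)) ⊆ Ris := by
          intro x hx; rw [mem_insert] at hx; rcases hx with rfl | hx
          · exact hwRis
          · exact (mem_filter.mp hx).1
        have hcl := card_le_card hsub
        rw [card_insert_of_notMem hwnot] at hcl
        have hgreedy' : Xset.card ≤ (Ris.filter (fun w => ∃ s ∈ Xset, g ((p b).1 s) l₀ < go w)).card := by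
          convert hgreedy using 3
        omega
      · -- no X-rows: any rising row will do; the column with the largest old slope is a descent
        rw [not_nonempty_iff_eq_empty] at hXne
        rw [hXne, card_empty]
        obtain ⟨j₀, hj₀, hmax⟩ := exists_max_image Crow gx hCne
        have hπj₀ : πe j₀ ∈ Crow := (hπmem j₀).mpr hj₀
        have hle : go j₀ ≤ gx j₀ := hmax (πe j₀) hπj₀
        have hlt : go j₀ < gx j₀ := lt_of_le_of_ne hle (fun e => hne_go j₀ hj₀ e.symm)
        have : j₀ ∈ Ris := by rw [mem_filter]; exact ⟨hj₀, (hdesc_iff j₀ hj₀).mp hlt⟩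
        have := card_pos.mpr ⟨j₀, this⟩
        omega
    have hval_split : ∀ j ∈ Crow, val j = (1 - (if (p a).2 j = l₁ then 1 else 0)) - (if gx j < g ((p b).1 j) l₀ then 1 else 0) := by
      intro j hj
      have htop : (gx j < g ((p a).1 j) l₁) ↔ ¬ ((p a).2 j = l₁) := by
        constructor
        · intro h he; apply absurd h; rw [show gx j = g ((p a).1 j) l₁ from by simp only [gx, he]]; exact lt_irrefl _
        · intro h; refine lt_of_le_of_ne (gtop _ _) fun he => h ?_
          exact (hgen _ _ _ _ he).2
      simp only [val]
      by_cases ht : (p a).2 j = l₁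
      · rw [if_neg (fun h => (htop.mp h) ht), if_pos ht]; ring
      · rw [if_pos (htop.mpr ht), if_neg ht]; ring
    have hsumCrow : Crow.Nonempty → 1 ≤ ∑ j ∈ Crow, val j := by
      intro hCne
      have e1 : ∑ j ∈ Crow, val j = ∑ j ∈ Crow, (1:ℤ) - ∑ j ∈ Crow, (if (p a).2 j = l₁ then (1:ℤ) else 0)
          - ∑ j ∈ Crow, (if gx j < g ((p b).1 j) l₀ then (1:ℤ) else 0) := by
        rw [← sum_sub_distrib, ← sum_sub_distrib]
        exact sum_congr rfl (fun j hj => by rw [hval_split j hj])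
      have e2 : ∑ j ∈ Crow, (1:ℤ) = (Crow.card : ℤ) := by rw [sum_const, nsmul_eq_mul, mul_one]
      have e3 : ∑ j ∈ Crow, (if (p a).2 j = l₁ then (1:ℤ) else 0) = (A1.card : ℤ) := by rw [sum_boole]
      have e4 : ∑ j ∈ Crow, (if gx j < g ((p b).1 j) l₀ then (1:ℤ) else 0) = (Bset.card : ℤ) := by rw [sum_boole]
      rw [e1, e2, e3, e4]
      have h1 : (A1.card : ℤ) = A2.card := by exact_mod_cast hA12
      have hD := hLemmaD hCne
      have h3 : (A2.card : ℤ) + Bset.card ≤ Asc.card + Xset.card := by exact_mod_cast hAB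
      have h4 : (Asc.card : ℤ) + Ris.card = Crow.card := by exact_mod_cast hAscDesc
      have h5 : (Xset.card : ℤ) + 1 ≤ Ris.card := by exact_mod_cast hD
      linarith
    have hCne : C.Nonempty := by
      by_contra hC
      rw [not_nonempty_iff_eq_empty] at hC
      apply hne k
      have hall : ∀ j, (p a).1 j = (p b).1 j ∧ (p a).2 j = (p b).2 j := by
        intro j
        have : j ∉ C := by rw [hC]; exact notMem_empty _
        rw [mem_filter] at this; push Not at this
        exact this (mem_univ _)
      exact Prod.ext (Equiv.ext fun j => (hall j).1) (funext fun j => (hall j).2)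
    have hdiff : Φ a - Φ b = ∑ j, (Ψ ((p a).1 j) (gx j) - Ψ ((p b).1 j) (gz j)) := by simp only [Φ, gx, gz, sum_sub_distrib]
    have hge1 : ∑ j, (Ψ ((p a).1 j) (gx j) - Ψ ((p b).1 j) (gz j)) ≥ ∑ j ∈ C, val j := by
      have : ∑ j ∈ C, val j = ∑ j, (if j ∈ C then val j else 0) := by
        rw [sum_ite_mem, univ_inter]
      rw [this]
      apply sum_le_sum
      intro j _
      by_cases hj : j ∈ C
      · rw [if_pos hj]; linarith [hcolC j hj]
      · rw [if_neg hj]; linarith [hcol0 j hj]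
    have hge2 : ∑ j ∈ C, val j ≥ 1 := by
      rw [← sum_sdiff hCrowC]
      have hrel : ∑ j ∈ C \ Crow, val j = ((C \ Crow).card : ℤ) := by
        rw [card_eq_sum_ones, Nat.cast_sum]
        refine sum_congr rfl (fun j hj => ?_)
        rw [mem_sdiff] at hj
        rw [hval_relabel j hj.1 hj.2]; exact Nat.cast_one.symm
      rw [hrel]
      by_cases hCr : Crow.Nonempty
      · have := hsumCrow hCr
        have : (0:ℤ) ≤ ((C \ Crow).card : ℤ) := Int.natCast_nonneg _
        linarith
      · rw [not_nonempty_iff_eq_empty] at hCr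
        rw [hCr, sum_empty, sdiff_empty]
        have : 0 < C.card := card_pos.mpr hCne
        have : (1:ℤ) ≤ (C.card : ℤ) := by exact_mod_cast this
        linarith
    linarith
  -- telescope
  have h0 : Φ 0 ≤ (m : ℤ) * ((Mid.card : ℤ) + 1) := by
    calc Φ 0 = ∑ j, Ψ ((p 0).1 j) (g ((p 0).1 j) ((p 0).2 j)) := rfl
      _ ≤ ∑ _j : Fin m, ((Mid.card : ℤ) + 1) := sum_le_sum fun j _ => hΨle _ _
      _ = (m : ℤ) * ((Mid.card : ℤ) + 1) := by rw [sum_const, card_univ, Fintype.card_fin]; ring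
  exact_mod_cast le_of_potential Φ _ hstep h0 (sum_nonneg fun j _ => hΨnn _ _)

/-- **Corollary (format form).**  Under the hypotheses of `chain_le_of_universalGauge`: `n ≤ (K−2)·m² + m`. -/
theorem chain_le_of_universalGauge' (d : Fin K → ℕ) (v ε : Fin m → Fin m → Fin K → ℤ) (α β : Fin m → ℚ)
    (hgen : ∀ (i i' : Fin m) (l l' : Fin K), (d l : ℚ) - α i = (d l' : ℚ) - α i' → i = i' ∧ l = l')
    (l₀ l₁ : Fin K) (hd0 : ∀ l, d l₀ ≤ d l) (hd1 : ∀ l, d l ≤ d l₁) (h01 : d l₀ < d l₁)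
    {n : ℕ} (θ : Fin (n + 1) → ℤ) (hθ : StrictMono θ) (p : Fin (n + 1) → Equiv.Perm (Fin m) × (Fin m → Fin K))
    (hdom : ∀ k, IsDominant d v ε (θ k) (p k)) (hne : ∀ k : Fin n, p k.castSucc ≠ p k.succ)
    (hcert : ∀ (k : Fin (n + 1)) (j i : Fin m) (l : Fin K), ε i j l ≠ 0 →
      ((θ k : ℚ) * (d l : ℚ) - (v i j l : ℚ)) - (α i * (θ k : ℚ) + β i) ≤
        ((θ k : ℚ) * (d ((p k).2 j) : ℚ) - (v ((p k).1 j) j ((p k).2 j) : ℚ)) - (α ((p k).1 j) * (θ k : ℚ) + β ((p k).1 j))) :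
    n ≤ (K - 2) * m ^ 2 + m := by
  have h := chain_le_of_universalGauge d v ε α β hgen l₀ l₁ hd0 hd1 h01 θ hθ p hdom hne hcert
  have hl : l₀ ≠ l₁ := fun e => by rw [e] at h01; exact lt_irrefl _ h01
  rw [card_types_mid l₀ l₁ hl] at h
  calc n ≤ m * (m * (K - 2) + 1) := h
    _ = (K - 2) * m ^ 2 + m := by ring

end SingleGauge

end Summit.ValiantsHypothesis.ValiantsHypothesis.Theorems.KPlusLogSqLaw
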